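import Summits.CriticalPhenomena.PercolationContinuityZ3.Theorems.PercNearOneGluingNoHeavyLowerTailSahiCTCRtThreeSignedForm
import HarnessLib

/-!
# `NoHeavyLowerTail` (crux stmt-CriticalPhenomena-4575), P3 lane: A COMMON LOOP IN THE SUPPORT MAKES EVERY SQUAREFREE COEFFICIENT OF `R_3` NONNEGATIVE
# — the first row of the signed form settled by an injection into nested pairs of loop-containing cubes

Support file (seat `prim-l12-p3`, gen 46; `--supports stmt-CriticalPhenomena-4575`).  Memo
`run/shared/lean/prim/prim-l12/FROM-prim-l12-p3-g46-SIGNED-FORM-AND-EX-REFUTED.md` §3.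

By `…SahiCTCRtThreeSignedForm.coeff_ind_Rt_three_nonneg_of_le`, the squarefree coefficient `[s^V] R_3(𝒳,𝒵)` is `≥ 0` as soon as the nested small
pairs inside `V` (`(N,Y)`, `N` a common non-member and `Y` a common member, both of size `≤ 2`, disjoint) are dominated by the Kleitman surpluses
`κ(∅, V∖U)`, `#U ≤ 2`, plus the crossing small pairs.  THIS FILE proves that domination — without the crossing credit — whenever some `y ∈ V` is a
COMMON LOOP (`{y} ∈ 𝒳 ∩ 𝒵`):
* `sum_pairsAt_eq_card_pairsIn` : `Σ_{S ⊆ V} pairsAt A B (V∖S)` is the number `#disjPairs A B V` of disjoint pairs of `A × B` inside `V`;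
* `kap_neg_filter_eq_empty_of_loop`, `kap_eq_card_nested_of_loop` : a cube containing a common loop has NO crossing complementary pair, so its Kleitman
  surplus is the number of its nested complementary pairs (`…SahiCTCKleitmanSurplus.kap_eq_pairs`);
* `loopCube` / `card_images_le_kap` : the injection `(N,Y) ↦ (cube U; nested pair {N, V∖N∖U})` with `U = Y ∖ L` if the set `L` of common loops of `V` is
  contained in `Y` and `U = Y` otherwise — the member side always contains a common loop, and `U`, `N` determine `Y`;
* **`coeff_ind_Rt_three_nonneg_of_common_loop`** : `{y} ∈ 𝒳 ∩ 𝒵`, `y ∈ V` ⟹ `0 ≤ [s^V] R_3(𝒳,𝒵)` for all up-sets `𝒳, 𝒵` and every finset `V`.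
(In the lane's reduction `…RtThreeLoopFreeReduction` a single loop point is peeled instead; the point of this file is the METHOD — injections into
cubes without crossing pairs need no residual Kleitman argument — which is the proposed route for the loop-free rows, memo §4.)  Nothing is asserted
about the crux.
-/

noncomputable section

open scoped Classical

namespace Summit.CriticalPhenomena.PercolationContinuityZ3.Theorems.SahiCTCForms

open Finset MvPolynomial SahiCTCGenFun

variable {α : Type*} [DecidableEq α] [Fintype α]

/-! ### Disjoint pairs inside `V` -/

/-- The ordered pairs `(P,Q) ∈ A × B` that are disjoint and lie inside `V`. [this work] -/
def disjPairs (A B : Finset (Finset α)) (V : Finset α) : Finset (Finset α × Finset α) :=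
  (A ×ˢ B).filter fun PQ => Disjoint PQ.1 PQ.2 ∧ PQ.1 ∪ PQ.2 ⊆ V

omit [Fintype α] in
/-- **`Σ_{S ⊆ V} pairsAt A B (V∖S) = #disjPairs A B V`** (fibre over the complement of the union). [this work] -/
theorem sum_pairsAt_eq_card_pairsIn (A B : Finset (Finset α)) (V : Finset α) :
    ∑ S ∈ V.powerset, pairsAt A B (V \ S) = #(disjPairs A B V) := by
  rw [card_eq_sum_card_fiberwise (f := fun PQ : Finset α × Finset α => V \ (PQ.1 ∪ PQ.2)) (t := V.powerset)
    (fun PQ _ => by simp only [mem_coe, mem_powerset]; exact sdiff_subset)]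
  refine sum_congr rfl fun S hS => ?_
  have hSV : S ⊆ V := mem_powerset.1 hS
  unfold pairsAt disjPairs
  rw [filter_filter]
  congr 1
  ext PQ
  simp only [mem_filter, and_assoc]
  constructor
  · rintro ⟨hAB, hd, hU⟩
    refine ⟨hAB, hd, hU ▸ sdiff_subset, ?_⟩
    rw [hU, Finset.sdiff_sdiff_eq_self hSV]
  · rintro ⟨hAB, hd, hsub, hS'⟩
    refine ⟨hAB, hd, ?_⟩
    rw [← hS', Finset.sdiff_sdiff_eq_self hsub]

/-! ### A cube containing a common loop has no crossing complementary pair -/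

section Loop
variable {F G : Finset (Finset α)} (hF : IsUpperSet (F : Set (Finset α))) (hG : IsUpperSet (G : Set (Finset α)))

omit [Fintype α] in
include hF hG in
/-- If `y ∈ S'` is a common loop, no complementary pair of the cube `2^{S'}` is crossing (`𝒳`-only / `𝒵`-only). [this work] -/
theorem kap_neg_filter_eq_empty_of_loop {S' : Finset α} {y : α} (hy : y ∈ S') (hyF : ({y} : Finset α) ∈ F)
    (hyG : ({y} : Finset α) ∈ G) :
    (tr F ∅ S' \ tr G ∅ S').filter (fun U => S' \ U ∈ tr G ∅ S' ∧ S' \ U ∉ tr F ∅ S') = ∅ := by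
  refine filter_eq_empty_iff.2 fun U hU h => ?_
  rw [mem_sdiff, mem_tr_empty, mem_tr_empty] at hU
  obtain ⟨⟨hUS, hUF⟩, hUG⟩ := hU
  by_cases hyU : y ∈ U
  · exact hUG ⟨hUS, hG (singleton_subset_iff.2 hyU) hyG⟩
  · refine h.2 (mem_tr_empty.2 ⟨sdiff_subset, hF (singleton_subset_iff.2 ?_) hyF⟩)
    exact mem_sdiff.2 ⟨hy, hyU⟩

omit [Fintype α] in
include hF hG in
/-- **At a cube containing a common loop the Kleitman surplus is the number of nested complementary pairs** (members whose complement is a common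
non-member). [this work] -/
theorem kap_eq_card_nested_of_loop {S' : Finset α} {y : α} (hy : y ∈ S') (hyF : ({y} : Finset α) ∈ F) (hyG : ({y} : Finset α) ∈ G) :
    kap F G ∅ S' = #((tr F ∅ S' ∩ tr G ∅ S').filter fun U => S' \ U ∉ tr F ∅ S' ∧ S' \ U ∉ tr G ∅ S') := by
  rw [kap_eq_pairs, kap_neg_filter_eq_empty_of_loop hF hG hy hyF hyG, card_empty, Nat.cast_zero, sub_zero]

end Loop

/-! ### The injection -/

section Injection
variable (F G : Finset (Finset α)) (V : Finset α)

/-- The common loops inside `V`. [this work] -/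
def loopsIn : Finset α := V.filter fun w => ({w} : Finset α) ∈ F ∧ ({w} : Finset α) ∈ G

/-- The cube index of a nested small pair `(N, Y)`: `Y ∖ L` if the set `L` of common loops of `V` lies inside `Y`, and `Y` otherwise. [this work] -/
def loopCube (p : Finset α × Finset α) : Finset α := if loopsIn F G V ⊆ p.2 then p.2 \ loopsIn F G V else p.2

variable {F G V}

omit [Fintype α] in
/-- Membership in `loopsIn`. [this work] -/
theorem mem_loopsIn {w : α} : w ∈ loopsIn F G V ↔ w ∈ V ∧ ({w} : Finset α) ∈ F ∧ ({w} : Finset α) ∈ G := by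
  unfold loopsIn; rw [mem_filter]

omit [Fintype α] in
/-- The cube index lies inside the member `Y`. [this work] -/
theorem loopCube_subset (p : Finset α × Finset α) : loopCube F G V p ⊆ p.2 := by
  unfold loopCube; split_ifs
  · exact sdiff_subset
  · exact Subset.rfl

omit [Fintype α] in
/-- Some common loop of `V` avoids the cube index. [this work] -/
theorem exists_loop_not_mem_loopCube (hL : (loopsIn F G V).Nonempty) (p : Finset α × Finset α) :
    ∃ w ∈ loopsIn F G V, w ∉ loopCube F G V p := by
  unfold loopCube
  split_ifs with h
  · obtain ⟨w, hw⟩ := hL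
    exact ⟨w, hw, fun h' => (mem_sdiff.1 h').2 hw⟩
  · obtain ⟨w, hw, hw'⟩ := not_subset.1 h
    exact ⟨w, hw, hw'⟩

/-- A common non-member contains no common loop. [this work] -/
theorem disjoint_loopsIn_of_mem_smallN (hF : IsUpperSet (F : Set (Finset α))) {N : Finset α} (hN : N ∈ smallN F G) :
    Disjoint (loopsIn F G V) N := by
  refine disjoint_left.2 fun w hw hwN => ?_
  obtain ⟨-, hwF, -⟩ := mem_loopsIn.1 hw
  unfold smallN at hN
  exact (mem_filter.1 hN).2.1 (hF (singleton_subset_iff.2 hwN) hwF)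

end Injection

/-! ### The charge of each cube is at most its surplus -/

section Charge
variable {F G : Finset (Finset α)} (hF : IsUpperSet (F : Set (Finset α))) (hG : IsUpperSet (G : Set (Finset α))) (V : Finset α)

include hF hG in
/-- **The nested small pairs sent to the cube `U` inject into its nested complementary pairs**, via `(N, Y) ↦ V ∖ U ∖ N`; hence their number is at most
`κ(∅, V∖U)` (a cube receiving a pair contains a common loop, so `κ` counts nested pairs). [this work] -/
theorem card_images_le_kap (hL : (loopsIn F G V).Nonempty) (U : Finset α) :
    (#((disjPairs (smallN F G) (smallY F G) V).filter fun p => loopCube F G V p = U) : ℤ) ≤ kap F G ∅ (V \ U) := by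
  set I := (disjPairs (smallN F G) (smallY F G) V).filter fun p => loopCube F G V p = U with hI
  by_cases hI0 : I = ∅
  · rw [hI0, card_empty, Nat.cast_zero]; exact kap_nonneg hF hG _ _ (disjoint_empty_left _)
  obtain ⟨p₀, hp₀⟩ := nonempty_iff_ne_empty.2 hI0
  -- unpack a member of `I`
  have key : ∀ p ∈ I, p.1 ∈ smallN F G ∧ p.2 ∈ smallY F G ∧ Disjoint p.1 p.2 ∧ p.1 ∪ p.2 ⊆ V ∧ loopCube F G V p = U := fun p hp => by
    rw [hI, mem_filter] at hp
    unfold disjPairs at hp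
    rw [mem_filter, mem_product] at hp
    exact ⟨hp.1.1.1, hp.1.1.2, hp.1.2.1, hp.1.2.2, hp.2⟩
  -- a common loop `w ∈ V ∖ U`
  have hloop : ∀ p ∈ I, ∃ w ∈ loopsIn F G V, w ∉ U ∧ w ∉ p.1 := fun p hp => by
    obtain ⟨hN, -, -, -, hU⟩ := key p hp
    obtain ⟨w, hw, hwU⟩ := exists_loop_not_mem_loopCube hL p
    exact ⟨w, hw, hU ▸ hwU, fun hwN => disjoint_left.1 (disjoint_loopsIn_of_mem_smallN (V := V) hF hN) hw hwN⟩
  obtain ⟨w₀, hw₀, hw₀U, -⟩ := hloop p₀ hp₀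
  have hw₀V : w₀ ∈ V \ U := mem_sdiff.2 ⟨(mem_loopsIn.1 hw₀).1, hw₀U⟩
  rw [kap_eq_card_nested_of_loop hF hG hw₀V (mem_loopsIn.1 hw₀).2.1 (mem_loopsIn.1 hw₀).2.2, Nat.cast_le]
  -- `U ⊆ V` and `U` avoids `p.1`
  have hUV : U ⊆ V := by
    obtain ⟨-, -, -, hsub, hU⟩ := key p₀ hp₀
    rw [← hU]; exact (loopCube_subset p₀).trans (subset_union_right.trans hsub)
  refine card_le_card_of_injOn (fun p => (V \ U) \ p.1) (fun p hp => ?_) (fun p hp p' hp' h => ?_)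
  · rw [mem_coe] at hp
    obtain ⟨hN, hY, hd, hsub, hU⟩ := key p hp
    obtain ⟨w, hw, hwU, hwN⟩ := hloop p hp
    have hNU : Disjoint p.1 U := hU ▸ hd.mono_right (loopCube_subset p)
    have hNsub : p.1 ⊆ V \ U := fun x hx => mem_sdiff.2 ⟨hsub (mem_union_left _ hx), fun hxU => disjoint_left.1 hNU hx hxU⟩
    have hwM : w ∈ (V \ U) \ p.1 := mem_sdiff.2 ⟨mem_sdiff.2 ⟨(mem_loopsIn.1 hw).1, hwU⟩, hwN⟩
    have hMF : (V \ U) \ p.1 ∈ F := hF (singleton_subset_iff.2 hwM) (mem_loopsIn.1 hw).2.1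
    have hMG : (V \ U) \ p.1 ∈ G := hG (singleton_subset_iff.2 hwM) (mem_loopsIn.1 hw).2.2
    have hNF : p.1 ∉ F := by unfold smallN at hN; exact (mem_filter.1 hN).2.1
    have hNG : p.1 ∉ G := by unfold smallN at hN; exact (mem_filter.1 hN).2.2
    rw [mem_coe, mem_filter, mem_inter, mem_tr_empty, mem_tr_empty, Finset.sdiff_sdiff_eq_self hNsub, mem_tr_empty, mem_tr_empty]
    exact ⟨⟨⟨sdiff_subset, hMF⟩, ⟨sdiff_subset, hMG⟩⟩, fun h => hNF h.2, fun h => hNG h.2⟩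
  · rw [mem_coe] at hp hp'
    obtain ⟨hN, hY, hd, hsub, hU⟩ := key p hp
    obtain ⟨hN', hY', hd', hsub', hU'⟩ := key p' hp'
    have hNU : Disjoint p.1 U := hU ▸ hd.mono_right (loopCube_subset p)
    have hNU' : Disjoint p'.1 U := hU' ▸ hd'.mono_right (loopCube_subset p')
    have hNsub : p.1 ⊆ V \ U := fun x hx => mem_sdiff.2 ⟨hsub (mem_union_left _ hx), fun hxU => disjoint_left.1 hNU hx hxU⟩
    have hNsub' : p'.1 ⊆ V \ U := fun x hx => mem_sdiff.2 ⟨hsub' (mem_union_left _ hx), fun hxU => disjoint_left.1 hNU' hx hxU⟩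
    have h1 : p.1 = p'.1 := by
      have := congrArg (fun T => (V \ U) \ T) h
      simpa only [Finset.sdiff_sdiff_eq_self hNsub, Finset.sdiff_sdiff_eq_self hNsub'] using this
    -- the member is determined by the cube: case analysis on the rule
    have hL1 : Disjoint (loopsIn F G V) p.1 := disjoint_loopsIn_of_mem_smallN (V := V) hF hN
    have smallY_mem : ∀ {Y : Finset α}, Y ∈ smallY F G → Y ∈ F ∧ Y ∈ G ∧ #Y ≤ 2 := fun {Y} hY => by
      unfold smallY at hY
      rw [mem_filter] at hY
      have := hY.1; simp only [bySize, mem_filter, mem_powerset] at this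
      exact ⟨hY.2.1, hY.2.2, by omega⟩
    -- a common member of size ≤ 2 disjoint from the loops and from which adding `L` stays small is impossible
    have nomix : ∀ {Y Y' : Finset α}, Y ∈ smallY F G → Y' ∈ smallY F G → Y' ⊆ V → loopsIn F G V ⊆ Y → ¬ loopsIn F G V ⊆ Y' →
        Y \ loopsIn F G V = Y' → False := by
      intro Y Y' hY hY' hY'V hLY hLY' he
      obtain ⟨hYF, hYG, hYc⟩ := smallY_mem hY
      obtain ⟨hY'F, hY'G, -⟩ := smallY_mem hY'
      have hdisj : Disjoint Y' (loopsIn F G V) := by rw [← he]; exact sdiff_disjoint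
      have hcard : #Y' + #(loopsIn F G V) ≤ 2 := by
        rw [← card_union_of_disjoint hdisj, ← he, sdiff_union_of_subset hLY]; exact hYc
      obtain ⟨w, hw⟩ := hL
      have hLpos : 0 < #(loopsIn F G V) := card_pos.2 ⟨w, hw⟩
      -- so `#Y' ≤ 1`
      rcases Nat.lt_or_ge #Y' 1 with h0 | h1'
      · -- `Y' = ∅` is a common member: then every set is in `F`, contradicting `p.1 ∉ F`
        have hY'0 : Y' = ∅ := card_eq_zero.1 (by omega)
        have hNF : p.1 ∉ F := by unfold smallN at hN; exact (mem_filter.1 hN).2.1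
        exact hNF (hF (empty_subset _) (hY'0 ▸ hY'F))
      · -- `Y' = {v}` is a common loop of `V`, hence in `L`: contradiction with disjointness
        have hY'1 : #Y' = 1 := by omega
        obtain ⟨v, hv⟩ := card_eq_one.1 hY'1
        have hvL : v ∈ loopsIn F G V := mem_loopsIn.2 ⟨hY'V (hv ▸ mem_singleton_self v), hv ▸ hY'F, hv ▸ hY'G⟩
        exact disjoint_left.1 hdisj (hv ▸ mem_singleton_self v) hvL
    have h2 : p.2 = p'.2 := by
      have hc := hU.trans hU'.symm
      unfold loopCube at hc
      have hY'V : p'.2 ⊆ V := subset_union_right.trans hsub'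
      have hYV : p.2 ⊆ V := subset_union_right.trans hsub
      split_ifs at hc with ha hb hb'
      · rw [← sdiff_union_of_subset ha, ← sdiff_union_of_subset hb, hc]
      · exact (nomix hY hY' hY'V ha hb hc).elim
      · exact (nomix hY' hY hYV hb' ha hc.symm).elim
      · exact hc
    exact Prod.ext h1 h2

include hF hG in
/-- **THE NESTED SMALL PAIRS ARE DOMINATED BY THE TOP-CUBE SURPLUSES when `V` contains a common loop.** [this work] -/
theorem card_pairsIn_le_sum_kap (hL : (loopsIn F G V).Nonempty) :
    (#(disjPairs (smallN F G) (smallY F G) V) : ℤ) ≤ ∑ U ∈ V.powerset.filter (fun U => #U ≤ 2), kap F G ∅ (V \ U) := by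
  rw [card_eq_sum_card_fiberwise (f := loopCube F G V) (s := disjPairs (smallN F G) (smallY F G) V)
    (t := V.powerset.filter fun U => #U ≤ 2) (fun p hp => ?_)]
  · push_cast
    exact sum_le_sum fun U _ => card_images_le_kap hF hG V hL U
  · rw [mem_coe] at hp
    unfold disjPairs at hp
    rw [mem_filter, mem_product] at hp
    obtain ⟨⟨-, hY⟩, -, hsub⟩ := hp
    have hYc : #p.2 ≤ 2 := by
      unfold smallY at hY; rw [mem_filter] at hY
      have := hY.1; simp only [bySize, mem_filter, mem_powerset] at this; omega
    rw [mem_coe, mem_filter, mem_powerset]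
    exact ⟨(loopCube_subset p).trans (subset_union_right.trans hsub), (card_le_card (loopCube_subset p)).trans hYc⟩

end Charge

/-! ### The theorem -/

/-- **A COMMON LOOP IN THE SUPPORT MAKES THE SQUAREFREE COEFFICIENT OF `R_3` NONNEGATIVE**: for up-sets `𝒳, 𝒵`, a finset `V` and `y ∈ V` with
`{y} ∈ 𝒳 ∩ 𝒵`, `0 ≤ [s^V] R_3(𝒳,𝒵)` (memo g46 §3: top-cube Kleitman surpluses alone pay for all nested small pairs). [this work] -/
theorem coeff_ind_Rt_three_nonneg_of_common_loop {F G : Finset (Finset α)} (hF : IsUpperSet (F : Set (Finset α)))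
    (hG : IsUpperSet (G : Set (Finset α))) {V : Finset α} {y : α} (hyV : y ∈ V) (hyF : ({y} : Finset α) ∈ F)
    (hyG : ({y} : Finset α) ∈ G) : 0 ≤ (Rt 3 F G).coeff (ind V) := by
  have hL : (loopsIn F G V).Nonempty := ⟨y, mem_loopsIn.2 ⟨hyV, hyF, hyG⟩⟩
  refine coeff_ind_Rt_three_nonneg_of_le F G V ?_
  have h1 : ∑ S ∈ V.powerset, (pairsAt (smallN F G) (smallY F G) (V \ S) : ℤ) = #(disjPairs (smallN F G) (smallY F G) V) := by
    rw [← sum_pairsAt_eq_card_pairsIn]; push_cast; rfl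
  have h2 : 0 ≤ ∑ S ∈ V.powerset, (pairsAt (smallXo F G) (smallZo F G) (V \ S) : ℤ) :=
    sum_nonneg fun S _ => Int.natCast_nonneg _
  rw [h1]
  have := card_pairsIn_le_sum_kap hF hG V hL
  linarith

end Summit.CriticalPhenomena.PercolationContinuityZ3.Theorems.SahiCTCForms
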